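import Mathlib
import Summits.MatrixMultiplication.MatrixMultiplication.Theses.FourierTwoFamiliesModP
import Summits.MatrixMultiplication.MatrixMultiplication.Theorems.FourierTwoFamiliesModPPowerGainRefutes

/-!
# Crux-strategist gen 1 — typed statements behind STRATEGY-CENSUS.md (crux stmt-MatrixMultiplication-14308,
# `FourierTwoFamiliesModP.PrimeTwoFamilies`)

Scratch file of planner-cstrat-stmt-MatrixMultiplication-14308-s1-0 (2026-08-16).  Nothing here is a line or a
registered stub; the file only makes the census's new objects precise and checks the cheap implications.

* §1 `DefectRatioZero` — the EASY END of the scale ("BehrendSDPP": balanced SDPP configurations of density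
  `ns/p ≥ s^{-c}` for every `c > 0`), PROVED equivalent to `¬ PrimeCyclicPowerGain` (route support stmt-14309)
  and PROVED to follow from the crux (landed kill link `PowerGainRefutes_proof`).  The would-be decomposition
  `DefectRatioZero → Boost → crux` is typed (`primeTwoFamilies_of_split`) to exhibit that its second piece is a
  modus-ponens cut (costume), census §Decomposition D-g1.1.
* §2 scale calculus — `PackingTightAt`, `SingleScaleDefect` (verbatim from `Lines/Sketch.lean`) and the two
  monotonicity statements that make "c(γ)/γ non-decreasing" formal: `packingTightAt_anti` (tightness propagates
  DOWN the scale, padding) and `singleScaleDefect_up` (a power defect propagates UP the scale with the constant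
  scaled by `γ'/γ`).  Both provable now from the landed padding lemma `CapacityLift.sdpp_pad` + the tree transfer
  `exists_prime_sdpp_of_addEquiv`; left `sorry` here (prover-sized, M).  Consequence recorded in the census: every
  FINAL segment of scales is the crux and every INITIAL segment is only necessary; the kill side is cheapest at the
  smallest scale.
* §3 `interval_equiSum_min_sep` + `interval_equiSum_card_le` — gen-0's claim S5(4) ("interval F ⇒ wall") made
  TRANSLATE-FREE and DIRECTNESS-FREE and PROVED here (sorry-free): if every block has the same SUM interval
  `A i + C i = [u, u+N)` and cross sums avoid it, the minima of the `A i` are pairwise `≥ N` apart, hence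
  `n ≤ L/N + 1` for blocks in a window `[0, L)` — the wall, whatever the (Krasner–Ranulac-diverse) factorisations.
-/

set_option linter.dupNamespace false

namespace Summit.MatrixMultiplication.MatrixMultiplication.Cruxes.PrimeTwoFamilies.StrategistG1

open Finset
open scoped Pointwise
open Summit.MatrixMultiplication.MatrixMultiplication.Theses
open Summit.MatrixMultiplication.MatrixMultiplication.Theses.FourierTwoFamiliesModP

/-! ## §1 The easy end of the scale -/

/-- **DefectRatioZero** ("BehrendSDPP", the SDPP analogue of Behrend's theorem): for every `c > 0` and every
threshold `s₀` some prime cyclic group carries a balanced SDPP configuration with `s ≥ s₀` and `n·s^{1+c} > p`,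
i.e. density `ns/p > s^{-c}`.  Known: `c < 0.5459` is refuted by radix-9 digit designs (Cruxes/PrimeCyclicPowerGain/
Disproof.lean (c2)); every `c > 0` is open. -/
def DefectRatioZero : Prop :=
  ∀ c : ℝ, 0 < c → ∀ s₀ : ℕ, ∃ p : ℕ, p.Prime ∧ ∃ (n s : ℕ) (A B : Fin n → Finset (ZMod p)),
    s₀ ≤ s ∧ (∀ i : Fin n, (A i).card = s ∧ (B i).card = s) ∧
    (∀ i : Fin n, ∀ a ∈ A i, ∀ a' ∈ A i, ∀ b ∈ B i, ∀ b' ∈ B i,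
        (a - a') + (b - b') = 0 → a = a' ∧ b = b') ∧
    (∀ i j k : Fin n, ∀ a ∈ A i, ∀ a' ∈ A j, ∀ b ∈ B j, ∀ b' ∈ B k,
        (a - a') + (b - b') = 0 → i = k) ∧
    (p : ℝ) < (n : ℝ) * (s : ℝ) ^ (1 + c)

/-- `DefectRatioZero` is literally the negation of the route's kill engine `PrimeCyclicPowerGain`. -/
theorem defectRatioZero_iff_not_powerGain : DefectRatioZero ↔ ¬ PrimeCyclicPowerGain := by
  unfold DefectRatioZero PrimeCyclicPowerGain
  push Not
  rfl

/-- The crux implies the easy-end statement (landed kill link `PowerGainRefutes_proof`, stmt-14312). -/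
theorem defectRatioZero_of_primeTwoFamilies (hT : PrimeTwoFamilies) : DefectRatioZero :=
  defectRatioZero_iff_not_powerGain.2 fun hP => Theorems.PowerGainRefutes_proof hP hT

/-- The "boost" a milestone+boost split would need.  Its hypothesis is TRUE whenever the crux is
(`defectRatioZero_of_primeTwoFamilies`), so as a decomposition piece it is a modus-ponens cut (costume): no
operation that raises the co-volume scale of a design is known (products/padding/CRT only average exponents). -/
def Boost : Prop := DefectRatioZero → PrimeTwoFamilies

/-- The typed split `DefectRatioZero → Boost → PrimeTwoFamilies` — trivially glued, hence uninformative. -/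
theorem primeTwoFamilies_of_split (h₁ : DefectRatioZero) (h₂ : Boost) : PrimeTwoFamilies := h₂ h₁

/-! ## §2 Scale calculus (statements; proofs are padding + transfer, prover-sized) -/

/-- PACKING-TIGHT AT SCALE `γ` (verbatim from `Lines/Sketch.lean`). -/
def PackingTightAt (γ : ℝ) : Prop :=
  ∀ ε : ℝ, 0 < ε → ∀ p₀ : ℕ, ∃ p ≥ p₀, p.Prime ∧ ∃ (n : ℕ) (A B : Fin n → Finset (ZMod p)),
    (∀ i : Fin n, ∀ a ∈ A i, ∀ a' ∈ A i, ∀ b ∈ B i, ∀ b' ∈ B i,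
        (a - a') + (b - b') = 0 → a = a' ∧ b = b') ∧
    (∀ i j k : Fin n, ∀ a ∈ A i, ∀ a' ∈ A j, ∀ b ∈ B j, ∀ b' ∈ B k,
        (a - a') + (b - b') = 0 → i = k) ∧
    (∀ i : Fin n, (p : ℝ) ^ γ ≤ (((A i).card * (B i).card : ℕ) : ℝ)) ∧
    (p : ℝ) ^ (1 - γ / 2 - ε) ≤ (n : ℝ)

/-- SINGLE-SCALE DEFECT `c` AT SCALE `γ` (verbatim from `Lines/Sketch.lean`). -/
def SingleScaleDefect (γ c : ℝ) : Prop :=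
  ∃ p₀ : ℕ, ∀ p : ℕ, p.Prime → p₀ ≤ p → ∀ (n : ℕ) (A B : Fin n → Finset (ZMod p)),
    (∀ i : Fin n, ∀ a ∈ A i, ∀ a' ∈ A i, ∀ b ∈ B i, ∀ b' ∈ B i,
        (a - a') + (b - b') = 0 → a = a' ∧ b = b') →
    (∀ i j k : Fin n, ∀ a ∈ A i, ∀ a' ∈ A j, ∀ b ∈ B j, ∀ b' ∈ B k,
        (a - a') + (b - b') = 0 → i = k) →
    (∀ i : Fin n, (p : ℝ) ^ γ ≤ (((A i).card * (B i).card : ℕ) : ℝ)) →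
    (n : ℝ) ≤ (p : ℝ) ^ (1 - γ / 2 - c)

/-- Tightness propagates DOWN the scale: pad a tight family at scale `γ'` by the singleton design of `ZMod M`,
`M ≈ p^{γ'/γ - 1}`, and transfer (`sdpp_pad`, `exists_prime_sdpp_of_addEquiv`).  Hence every final segment
`{γ ≥ γ₀}` of `∀ γ, PackingTightAt γ` is equivalent to the whole (census D1 of gen 0, now typed). -/
theorem packingTightAt_anti {γ γ' : ℝ} (hγ : 0 < γ) (hle : γ ≤ γ') (hγ' : γ' < 1) :
    PackingTightAt γ' → PackingTightAt γ := by
  sorry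

/-- A power defect propagates UP the scale, with the constant IMPROVED by the factor `γ'/γ ≥ 1` (up to `ε`):
the contrapositive of the same padding.  This is the formal content of "c(γ)/γ is non-decreasing"; in particular
the kill side may work at the SMALLEST convenient scale, and `PrimeCyclicPowerGain` is exactly
`lim_{γ→0} c(γ)/γ > 0`. -/
theorem singleScaleDefect_up {γ γ' c : ℝ} (hγ : 0 < γ) (hle : γ ≤ γ') (hγ' : γ' < 1) (hc : 0 < c) :
    SingleScaleDefect γ c → ∀ ε : ℝ, 0 < ε → ε < c → SingleScaleDefect γ' ((c - ε) * γ' / γ) := by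
  sorry

/-! ## §3 Interval sum sets are wall-bound (translate-free, directness-free) -/

/-- **Interval equi-sum families are `N`-separated.**  Over `ℤ` (no wrap-around): if every block has the same
sum interval `A i + C i = [u, u+N)` and every cross sum set `A i + C k` (`i ≠ k`) avoids `[u, u+N)`, then the
minima of the `A i` are pairwise at distance `≥ N`; consequently `n ≤ diam(⋃ A i)/N + 1` — the translate wall,
for ARBITRARY (Krasner–Ranulac-diverse) factorisations of the interval and without using directness.
Proof (shorter than planned — maxima are not needed).  Write `αᵢ = min A i`, `γᵢ = min C i`.  Since
`u ∈ [u, u+N) = A i + C i` and `αᵢ + γᵢ ∈ A i + C i ⊆ [u, u+N)`, we get `αᵢ + γᵢ = u` for every `i`.  For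
`i ≠ k` the two cross sums `αᵢ + γₖ = u + (αᵢ - αₖ)` and `αₖ + γᵢ = u + (αₖ - αᵢ)` both avoid the hole
`[u, u+N)`, i.e. `d := αᵢ - αₖ` satisfies `(d < 0 ∨ d ≥ N) ∧ (d > 0 ∨ d ≤ -N)`, whence `|d| ≥ N`. ∎ -/
theorem interval_equiSum_min_sep {n N : ℕ} {u : ℤ} (A C : Fin n → Finset ℤ)
    (hA : ∀ i, (A i).Nonempty) (hC : ∀ i, (C i).Nonempty)
    (hsum : ∀ i, A i + C i = Finset.Ico u (u + N))
    (hX : ∀ i k, i ≠ k → Disjoint (A i + C k) (Finset.Ico u (u + N))) :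
    ∀ i k, i ≠ k → (N : ℤ) ≤ |(A i).min' (hA i) - (A k).min' (hA k)| := by
  intro i k hik
  -- the target interval is nonempty, so `0 < N`
  have hne : (Finset.Ico u (u + N)).Nonempty := by rw [← hsum i]; exact (hA i).add (hC i)
  have huN : u < u + N := Finset.nonempty_Ico.1 hne
  -- key identity: `min (A j) + min (C j) = u`
  have key : ∀ j, (A j).min' (hA j) + (C j).min' (hC j) = u := by
    intro j
    apply le_antisymm
    · have hu : u ∈ A j + C j := by rw [hsum j]; exact Finset.mem_Ico.2 ⟨le_rfl, huN⟩
      obtain ⟨a, ha, c, hc, hac⟩ := Finset.mem_add.1 hu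
      rw [← hac]
      exact add_le_add (Finset.min'_le _ _ ha) (Finset.min'_le _ _ hc)
    · have hmem : (A j).min' (hA j) + (C j).min' (hC j) ∈ A j + C j :=
        Finset.add_mem_add (Finset.min'_mem _ _) (Finset.min'_mem _ _)
      rw [hsum j] at hmem
      exact (Finset.mem_Ico.1 hmem).1
  -- hole property: cross sums avoid `[u, u+N)`
  have hole : ∀ i k, i ≠ k → ∀ x ∈ A i + C k, x < u ∨ u + N ≤ x := by
    intro i k hik x hx
    have hx' : x ∉ Finset.Ico u (u + N) := Finset.disjoint_left.1 (hX i k hik) hx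
    rw [Finset.mem_Ico, not_and_or, not_le, not_lt] at hx'
    exact hx'
  have h1 := hole i k hik ((A i).min' (hA i) + (C k).min' (hC k))
    (Finset.add_mem_add (Finset.min'_mem _ _) (Finset.min'_mem _ _))
  have h2 := hole k i (Ne.symm hik) ((A k).min' (hA k) + (C i).min' (hC i))
    (Finset.add_mem_add (Finset.min'_mem _ _) (Finset.min'_mem _ _))
  have ki := key i
  have kk := key k
  rcases h1 with h1 | h1 <;> rcases h2 with h2 | h2
  · exfalso; linarith
  · rw [abs_sub_comm]
    exact le_trans (by linarith) (le_abs_self _)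
  · exact le_trans (by linarith) (le_abs_self _)
  · exfalso; linarith

/-- Counting corollary: if moreover all `A i` live in a window `[0, L)`, then `n ≤ L / N + 1` (the translate wall
`n·N ≲ L` for interval equi-sum families, whatever the factorisations). -/
theorem interval_equiSum_card_le {n N L : ℕ} {u : ℤ} (A C : Fin n → Finset ℤ)
    (hA : ∀ i, (A i).Nonempty) (hC : ∀ i, (C i).Nonempty)
    (hsum : ∀ i, A i + C i = Finset.Ico u (u + N))
    (hX : ∀ i k, i ≠ k → Disjoint (A i + C k) (Finset.Ico u (u + N)))
    (hwin : ∀ i, A i ⊆ Finset.Ico (0 : ℤ) L) (hN : 0 < N) :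
    n ≤ L / N + 1 := by
  have sep := interval_equiSum_min_sep A C hA hC hsum hX
  have hNz : (0 : ℤ) < N := by exact_mod_cast hN
  -- the minima, and their quotients by `N`
  have hα : ∀ i, 0 ≤ (A i).min' (hA i) ∧ (A i).min' (hA i) < L := fun i =>
    Finset.mem_Ico.1 (hwin i (Finset.min'_mem _ _))
  let f : Fin n → ℕ := fun i => (((A i).min' (hA i)) / (N : ℤ)).toNat
  have hq : ∀ i, ((f i : ℕ) : ℤ) = (A i).min' (hA i) / (N : ℤ) := fun i =>
    Int.toNat_of_nonneg (Int.ediv_nonneg (hα i).1 hNz.le)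
  have hf : ∀ i, f i ∈ Finset.range (L / N + 1) := by
    intro i
    rw [Finset.mem_range, Nat.lt_add_one_iff]
    have h1 : (A i).min' (hA i) / (N : ℤ) ≤ (L : ℤ) / (N : ℤ) :=
      Int.ediv_le_ediv hNz (hα i).2.le
    have h2 : ((f i : ℕ) : ℤ) ≤ ((L / N : ℕ) : ℤ) := by rw [hq i, Int.natCast_div]; exact h1
    exact_mod_cast h2
  have hinj : Set.InjOn f (Finset.univ : Finset (Fin n)) := by
    intro i _ k _ hfik
    by_contra hik
    have hqq : (A i).min' (hA i) / (N : ℤ) = (A k).min' (hA k) / (N : ℤ) := by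
      rw [← hq i, ← hq k]; exact_mod_cast hfik
    have hs := sep i k hik
    have ei := Int.mul_ediv_add_emod ((A i).min' (hA i)) (N : ℤ)
    have ek := Int.mul_ediv_add_emod ((A k).min' (hA k)) (N : ℤ)
    have ri0 := Int.emod_nonneg ((A i).min' (hA i)) hNz.ne'
    have riN := Int.emod_lt_of_pos ((A i).min' (hA i)) hNz
    have rk0 := Int.emod_nonneg ((A k).min' (hA k)) hNz.ne'
    have rkN := Int.emod_lt_of_pos ((A k).min' (hA k)) hNz
    rw [hqq] at ei
    have hlt : |(A i).min' (hA i) - (A k).min' (hA k)| < N := by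
      rw [abs_lt]; constructor <;> linarith
    linarith
  have hcard := Finset.card_le_card_of_injOn f (fun i _ => hf i) hinj
  simpa using hcard

end Summit.MatrixMultiplication.MatrixMultiplication.Cruxes.PrimeTwoFamilies.StrategistG1
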